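import Mathlib
import HarnessLib
import Literature.AlgebraicGeometry.HyperbolicPolynomials.SpectrahedralShadow
import Summits.ValiantsHypothesis.ValiantsHypothesis.Theorems.PermanentalConesHyperbolicVPShadowStubRealifyHermitianPencil
import Summits.ValiantsHypothesis.ValiantsHypothesis.Theorems.PermanentalConesHyperbolicVPShadowStubSpectrahedronOfSymmDetPower
import Summits.ValiantsHypothesis.ValiantsHypothesis.Theorems.PermanentalConesHyperbolicVPShadowStubOshimeFamily2Spectrahedron

/-!
# ValiantsHypothesis / PermanentalCones — `HyperbolicVPShadow`, stub O₂ʰ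

Route `PermanentalCones`, item `stmt-ValiantsHypothesis-8655` (crux `HyperbolicVPShadow`), line
`birth`, stub `stub_oshimeFamily2h_spectrahedron`.

Oshime's family (2) of non-symmetrisable linear pencils of real `3 × 3` matrices with only real
eigenvalues (Oshime 1991, Thm 4.7), *homogenised*: `P(x) = x₀ 1 + x₁ A + x₂ B + x₃ C` with
`A = diag(1, 0, 0)`, `B = !![0, α, 0; α, 1, 0; 0, 0, -1]`, `C = !![0, β, γ; β', 0, 1; γ', 1, 0]`,
`α > 0`, `D := 2αγ − α² − β² > 0`, `D' := 2αγ' − α² − β'² > 0`. We show that its closed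
nonnegative-spectrum cone `{x : ∀ τ > 0, det (P x + τ·1) ≠ 0}` is a lifted-LMI set of size `6`.

## Proof

This is the homogenised companion of `stub_oshimeFamily2_spectrahedron`, whose Hermitian
certificate we reuse: `permanentalCones_oshime2_certificate` supplies reals `m, u, q` with
`m² = αu − δ²`, `mq = su/2 − ρδ`, `q² = u(2σ − α − u) − ρ²` (`s := β + β'`, `δ := (β − β')/2`,
`σ := (γ + γ')/2`, `ρ := (γ − γ')/2`), and `permanentalCones_oshime2_detIdentity` gives
`det (t·1 + y₀ A + y₁ B + y₂ S₃) = det (t·1 + y₀ A + y₁ B + y₂ C)` for the Hermitian matrix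
`S₃ := !![0, s/2 + m i, p + q i; s/2 − m i, 0, 1; p − q i, 1, 0]`, `p := σ − u`. For the
homogenised pencil `P x + τ·1` is that right-hand matrix at `t := τ + x₀`, `(y₀, y₁, y₂) :=
(x₁, x₂, x₃)`. Realifying the Hermitian pencil `H x = x₀ 1 + x₁ A + x₂ B + x₃ S₃`
(`stub_realify_hermitianPencil`) gives a real symmetric pencil `L` of size `2·3` with
`det (L x + τ·1) = det (P x + τ·1)²`, and `stub_spectrahedron_of_symmDetPower` (`k = 2`) turns
this into a size-`6` lifted-LMI description of the cone. No definitions are introduced: all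
matrices are literals, the two pencils are `Fintype.linearCombination ℝ ![…]`.
-/

-- `<Problem> = <Summit>` for this single-conjunct summit (lakefile sets the same option tree-wide).
set_option linter.dupNamespace false

namespace Summit.ValiantsHypothesis.ValiantsHypothesis.Theorems

open Matrix Complex

/-- **Stub (Oshime's family (2), homogenised, has size-`6` spectrahedral cones).** For `α > 0`,
`2αγ − α² − β² > 0`, `2αγ' − α² − β'² > 0`, the closed nonnegative-spectrum cone
`{x : ∀ τ > 0, det (x₀ 1 + x₁ A + x₂ B + x₃ C + τ·1) ≠ 0}` of the homogenised real-spectrum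
pencil `A = diag(1,0,0)`, `B = !![0, α, 0; α, 1, 0; 0, 0, -1]`,
`C = !![0, β, γ; β', 0, 1; γ', 1, 0]` (Oshime 1991, Thm 4.7, family (2)) is a lifted-LMI set of
size `6`: a Hermitian `3 × 3` determinantal representation, realified to a symmetric `6 × 6`
representation of the square of `det (P x + τ·1)`. [folklore] -/
theorem stub_oshimeFamily2h_spectrahedron :
    ∀ α β β' γ γ' : ℝ, 0 < α → 0 < 2 * α * γ - α ^ 2 - β ^ 2 → 0 < 2 * α * γ' - α ^ 2 - β' ^ 2 →
      Literature.AlgebraicGeometry.HyperbolicPolynomials.IsSpectrahedralShadowOfSize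
        {x : Fin 4 → ℝ | ∀ τ : ℝ, 0 < τ →
          (x 0 • (1 : Matrix (Fin 3) (Fin 3) ℝ) + x 1 • !![(1 : ℝ), 0, 0; 0, 0, 0; 0, 0, 0] +
            x 2 • !![0, α, 0; α, 1, 0; 0, 0, -1] +
            x 3 • !![0, β, γ; β', 0, 1; γ', 1, 0] +
            τ • (1 : Matrix (Fin 3) (Fin 3) ℝ)).det ≠ 0} 6 := by
  intro α β β' γ γ' hα hD hD'
  obtain ⟨m, u, q, R1, R2, R3⟩ := permanentalCones_oshime2_certificate α β β' γ γ' hα hD hD'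
  obtain ⟨b₀, hb₀⟩ : ∃ b₀ : ℝ, b₀ = (β + β') / 2 := ⟨_, rfl⟩
  obtain ⟨p₀, hp₀⟩ : ∃ p₀ : ℝ, p₀ = (γ + γ') / 2 - u := ⟨_, rfl⟩
  -- the real pencil `P x = x 0 • 1 + x 1 • A + x 2 • B + x 3 • C`
  let P : (Fin 4 → ℝ) →ₗ[ℝ] Matrix (Fin 3) (Fin 3) ℝ := Fintype.linearCombination ℝ
    ![(1 : Matrix (Fin 3) (Fin 3) ℝ), !![(1 : ℝ), 0, 0; 0, 0, 0; 0, 0, 0],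
      !![0, α, 0; α, 1, 0; 0, 0, -1], !![0, β, γ; β', 0, 1; γ', 1, 0]]
  have hP : ∀ x : Fin 4 → ℝ, P x = x 0 • (1 : Matrix (Fin 3) (Fin 3) ℝ) +
      x 1 • !![(1 : ℝ), 0, 0; 0, 0, 0; 0, 0, 0] + x 2 • !![0, α, 0; α, 1, 0; 0, 0, -1] +
      x 3 • !![0, β, γ; β', 0, 1; γ', 1, 0] := fun x => by
    simp only [P, Fintype.linearCombination_apply, Fin.sum_univ_four, Matrix.cons_val_zero,
      Matrix.cons_val_one, Matrix.cons_val_two, Matrix.cons_val_three, Matrix.head_cons,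
      Matrix.tail_cons]
  have hPx : ∀ (x : Fin 4 → ℝ) (τ : ℝ), P x + τ • (1 : Matrix (Fin 3) (Fin 3) ℝ) =
      !![τ + x 0 + x 1, α * x 2 + β * x 3, γ * x 3; α * x 2 + β' * x 3, τ + x 0 + x 2, x 3;
        γ' * x 3, x 3, τ + x 0 - x 2] := fun x τ => by
    rw [hP]
    ext i j
    fin_cases i <;> fin_cases j <;> simp <;> ring
  -- the Hermitian pencil `H x = x 0 • 1 + x 1 • A + x 2 • B + x 3 • S₃`
  let Aℂ : Matrix (Fin 3) (Fin 3) ℂ := !![1, 0, 0; 0, 0, 0; 0, 0, 0]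
  let Bℂ : Matrix (Fin 3) (Fin 3) ℂ := !![0, (α : ℂ), 0; (α : ℂ), 1, 0; 0, 0, -1]
  let S₃ : Matrix (Fin 3) (Fin 3) ℂ :=
    !![0, (b₀ : ℂ) + m * I, (p₀ : ℂ) + q * I; (b₀ : ℂ) - m * I, 0, 1; (p₀ : ℂ) - q * I, 1, 0]
  have hIh : (1 : Matrix (Fin 3) (Fin 3) ℂ).IsHermitian := Matrix.isHermitian_one
  have hAh : Aℂ.IsHermitian := Matrix.IsHermitian.ext fun i j => by
    fin_cases i <;> fin_cases j <;> simp [Aℂ]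
  have hBh : Bℂ.IsHermitian := Matrix.IsHermitian.ext fun i j => by
    fin_cases i <;> fin_cases j <;> simp [Bℂ]
  have hSh : S₃.IsHermitian := Matrix.IsHermitian.ext fun i j => by
    fin_cases i <;> fin_cases j <;> simp [S₃, Complex.ext_iff]
  let H : (Fin 4 → ℝ) →ₗ[ℝ] Matrix (Fin 3) (Fin 3) ℂ :=
    Fintype.linearCombination ℝ ![(1 : Matrix (Fin 3) (Fin 3) ℂ), Aℂ, Bℂ, S₃]
  have hH : ∀ x : Fin 4 → ℝ, H x = x 0 • (1 : Matrix (Fin 3) (Fin 3) ℂ) + x 1 • Aℂ + x 2 • Bℂ +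
      x 3 • S₃ := fun x => by
    simp only [H, Fintype.linearCombination_apply, Fin.sum_univ_four, Matrix.cons_val_zero,
      Matrix.cons_val_one, Matrix.cons_val_two, Matrix.cons_val_three, Matrix.head_cons,
      Matrix.tail_cons]
  have hHerm : ∀ x : Fin 4 → ℝ, (H x).IsHermitian := fun x => by
    rw [hH]
    exact (((hIh.smul (IsSelfAdjoint.all _)).add (hAh.smul (IsSelfAdjoint.all _))).add
      (hBh.smul (IsSelfAdjoint.all _))).add (hSh.smul (IsSelfAdjoint.all _))
  have hHx : ∀ (x : Fin 4 → ℝ) (τ : ℝ), H x + (τ : ℂ) • (1 : Matrix (Fin 3) (Fin 3) ℂ) =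
      !![(((τ + x 0 : ℝ) : ℂ)) + x 1, α * x 2 + x 3 * (b₀ + m * I), x 3 * (p₀ + q * I);
        α * x 2 + x 3 * (b₀ - m * I), ((τ + x 0 : ℝ) : ℂ) + x 2, x 3;
        x 3 * (p₀ - q * I), x 3, ((τ + x 0 : ℝ) : ℂ) - x 2] := fun x τ => by
    rw [hH]
    ext i j
    fin_cases i <;> fin_cases j <;> simp [Aℂ, Bℂ, S₃, Matrix.smul_apply] <;> ring
  -- the determinantal identity `det (H x + τ·1) = det (P x + τ·1)`
  have hdet : ∀ (x : Fin 4 → ℝ) (τ : ℝ), (H x + (τ : ℂ) • (1 : Matrix (Fin 3) (Fin 3) ℂ)).det =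
      (((P x + τ • (1 : Matrix (Fin 3) (Fin 3) ℝ)).det : ℝ) : ℂ) := fun x τ => by
    rw [hHx, hPx]
    exact permanentalCones_oshime2_detIdentity α β β' γ γ' m u q b₀ p₀ hb₀ hp₀ R1 R2 R3 (τ + x 0)
      (x 1) (x 2) (x 3)
  -- realification: a symmetric pencil of size `2·3` representing the square of `det (P x + τ·1)`
  obtain ⟨L, hLsymm, hLdet⟩ := stub_realify_hermitianPencil 4 3 H hHerm
  have hLdet' : ∀ (x : Fin 4 → ℝ) (τ : ℝ),
      (L x + τ • (1 : Matrix (Fin (2 * 3)) (Fin (2 * 3)) ℝ)).det =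
        ((P x + τ • (1 : Matrix (Fin 3) (Fin 3) ℝ)).det) ^ 2 := fun x τ => by
    have h := hLdet x τ
    simp only [Complex.coe_algebraMap] at h
    have hs : star (((P x + τ • (1 : Matrix (Fin 3) (Fin 3) ℝ)).det : ℝ) : ℂ) =
        ((P x + τ • (1 : Matrix (Fin 3) (Fin 3) ℝ)).det : ℝ) := Complex.conj_ofReal _
    rw [hdet x τ, hs, ← Complex.ofReal_mul] at h
    rw [sq]
    exact_mod_cast h
  have h6 := stub_spectrahedron_of_symmDetPower 4 3 (2 * 3) 2 P L two_ne_zero hLsymm hLdet'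
  simp only [hP] at h6
  exact h6

end Summit.ValiantsHypothesis.ValiantsHypothesis.Theorems
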